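import Literature.AlgebraicGeometry.Motives.HodgeStructureReducedModule
import Literature.NumberTheory.ComplexMultiplication.CMAlgebraTorusSimpleSubalgebraRosatiStable
import Literature.RingTheory.CentralSimple.ReducedDegreeCentralizerSimpleSubalgebra
import Literature.RingTheory.CentralSimple.SemisimpleCentralizer
import Literature.RingTheory.SimpleModule.CommutantCommutativeCMCriterion
import HarnessLib

/-!
# Complex multiplication relative to a simple `L ⊆ E_φ`, for a polarizable `ℚ`-Hodge structure: `d · [E_φ ∩ C(L)]_red
# ≤ dim V`, with equality iff CM, and then with a commutative reduced `R` STABLE UNDER THE ROSATI INVOLUTION of any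
# polarization stabilising `L` (Milne, *Complex Multiplication*, Ch. I §3 Exercise 3.10 (a)(b) — Hodge-structure level)

[topic AlgebraicGeometry/Motives]

Family `hodge`, lane `lit-hodgefound` (Track 2 foundations library; skeleton seat `lit-hodgefound-skel-3`, generation 62,
row **A3-G148**), layer `Literature/AlgebraicGeometry/Motives`, namespace `Literature.AlgebraicGeometry.Motives.HodgeStructure`.
The HODGE-STRUCTURE-LEVEL reading of A3-G143 (Ex. 3.10 (a): torus level `NumberTheory/ComplexMultiplication/
CMAlgebraTorusSimpleSubalgebraCommutant`, abelian-variety level `AlgebraicGeometry/ComplexMultiplication/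
CMTypeSimpleSubalgebraCommutant`) and of A3-G147 (Ex. 3.10 (b): `…CMAlgebraTorusSimpleSubalgebraRosatiStable`, §6 of the
latter), for p02's `ℚ`-Hodge structures `H : HodgeStructure V n` with endomorphism algebra `E_φ = H.endAlg ⊆ End_ℚ(V)`
(`Motives/HodgeStructureEndAlgSemisimple`: semisimple for polarizable `H`, stable under the adjoint `† = Polarization.adjoint`
of every polarization — Huybrechts Lemma 3.3.12) and with «complex multiplication» read as Milne's Def. 3.2
`[E_φ : ℚ]_red = dim_ℚ V`, which A3-G146 FILE 5 (`Motives/HodgeStructureReducedModule`) identifies with «`MT(H)(ℚ)` is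
commutative» (Deligne's CM-type Hodge structures) for polarizable `H`.  THEOREMS ONLY (no definition, no instance, no
named fact; net debt `0`, D-0026).

## The print

J. S. Milne, *Complex Multiplication* [MilneCM2006], Ch. I §3 p. 29 (open text `paper:url-8ccc30e4daab`, p0029),
VERBATIM: «EXERCISE 3.10 Let `L` be a simple `ℚ`-algebra of finite degree `d²` over its centre `F`, and let `A` be an
abelian variety containing `L` in its endomorphism algebra. (a) Show that for any semisimple commutative `ℚ`-subalgebra
`R` of `End⁰_L(A)`, `dim_ℚ R ≤ (2 dim A)/d`, and that equality holds for some `R` if and only `A` has complex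
multiplication. (b) Let `′` be a Rosati involution on `End⁰(A)` stabilizing `L`; show that, if `A` has complex
multiplication, then there is an `R` as in (a) that is stabilized by `′`.»  Dictionary (Deligne, *Hodge cycles on
abelian varieties*, I §5: «`(V, h)` is of CM-type if its Mumford–Tate group is commutative»; Green–Griffiths–Kerr §V.B;
Moonen §2.1 «the choice of a polarization gives rise to an involution `d ↦ d*` on `D`»): `End⁰(A) ↦ E_φ = H.endAlg`,
`2 dim A ↦ dim_ℚ V`, «complex multiplication» `↦ [E_φ : ℚ]_red = dim_ℚ V`, Rosati involution `↦ ψ.adjoint`.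

## Proof route (`B = End_ℚ(V)`, central simple of degree `dim V`)

The BOUND is A3-G143 FILE 1's `d · [C_B(L) : ℚ]_red = dim V` (`End.mul_finrank_le_finrank_of_le_centralizer`).  CM ⟹
equality: a commutative reduced `T ⊆ E_φ` with `dim T = dim V` is its own commutant in `B`
(`SimpleModule.Commutant.centralizer_eq_self_of_comm_isReduced_finrank_eq`), so `Z = C_B(E_φ) ⊆ T` is commutative and
reduced; FILE 1 (B2) gives `d · [C_B(Z ∪ L)]_red = dim V`, and `C_B(Z ∪ L) = C_B(Z) ⊓ C_B(L) = E_φ ⊓ C_B(L)` by the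
bicommutant theorem for the semisimple `E_φ` (p11).  Equality ⟹ CM: FILE 1 (B3) makes `Z` commutative with `Z ⊆ R`, so
`[E_φ]_red = [C_B(Z)]_red = [B]_red = dim V`.  (b): `S = ℚ[L ∪ Z]` is `†`-stable (`L`, `E_φ`, hence `Z`, are) and
semisimple; `V` is a semisimple `S`-module on which `S` acts by `†`-adjointable operators, and A3-G147 FILE 2
(`SimpleModule/CommutantAdjointStableMaximalEtale`, Cimprič 2008 Lemma 5 in the block algebra of an orthogonal
decomposition of `V`) yields a `†`-stable commutative reduced `R ⊆ C_B(S) = E_φ ⊓ C_B(L)` maximal commutative there;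
`Z ⊆ R`, so `R` is a maximal étale subalgebra of the SIMPLE `C_B(L)` and `d · dim R = d · [C_B(L)]_red = dim V`.

## What is formalised (`H : HodgeStructure V n`, `L ≤ End_ℚ(V)` simple with `[L : ℚ] = d² · [Z(L) : ℚ]`)

* §1 **the bound** `mul_reducedDegree_endAlg_inf_centralizer_le_finrank` (`d · [E_φ ⊓ C(L) : ℚ]_red ≤ dim V`; the
  elementwise bound is the tree's `End.mul_finrank_le_finrank_of_le_centralizer`).
* §2 **CM ⟹ equality** (polarizable `H`, `L ≤ E_φ`): `mul_reducedDegree_endAlg_inf_centralizer_eq_finrank`,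
  `exists_le_endAlg_inf_centralizer_mul_finrank_eq_finrank`.
* §3 **equality ⟹ CM** (polarizable `H`): `reducedDegree_endAlg_eq_finrank_of_mul_finrank_eq`; the iff
  `exists_mul_finrank_eq_finrank_iff_reducedDegree_endAlg_eq`.
* §4 ★★★ **EX. 3.10 (b)** `exists_adjoint_stable_le_endAlg_inf_centralizer_mul_finrank_eq_finrank` (`ψ` a polarization,
  `[E_φ]_red = dim V`, `L ≤ E_φ` simple with `L† = L` ⟹ a commutative reduced `R ≤ E_φ ⊓ C(L)` with `d · dim R = dim V`
  and `R† = R`), the iff `exists_adjoint_stable_mul_finrank_eq_finrank_iff_reducedDegree_endAlg_eq`, the case `L = ℚ`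
  `exists_adjoint_stable_le_endAlg_finrank_eq_finrank` (a `†`-stable étale `R ⊆ E_φ` of rank `dim V`), and the
  Mumford–Tate forms `exists_adjoint_stable_mul_finrank_eq_finrank_of_mumfordTateGroup_comm`,
  `exists_adjoint_stable_mul_finrank_eq_finrank_iff_mumfordTateGroup_comm` (through A3-G146 FILE 5; these carry p02's
  standing `[HodgeTensorFacts]` hypothesis of the Tannaka-free Mumford–Tate group, not added here).
* §5 **equality ⟹ CM WITHOUT polarizability** (add-only append, seat `skel-3` generation 64, row A3-G151): the pure
  algebra «for a simple `L ⊆ End_F(W)` of degree `d` over its centre and a commutative reduced `R ⊆ C(L)` with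
  `d · dim_F R = dim_F W`, the algebra `F[L ∪ R]` is semisimple (a quotient of `L ⊗_F R`, Pierce §10.5), its commutant
  is `R` ((B3)), so by the double commutant `F[L ∪ R] = C(R) = End_R(W)` and `[F[L ∪ R] : F]_red = dim_F W`; hence EVERY
  subalgebra `E ⊇ L ∪ R` has `[E : F]_red = dim_F W`» — `isSemisimpleRing_adjoin_union_of_le_centralizer`,
  `centralizer_adjoin_union_eq_of_mul_finrank_eq`, `adjoin_union_eq_centralizer_of_mul_finrank_eq`,
  `reducedDegree_adjoin_union_eq_finrank_of_mul_finrank_eq`, `reducedDegree_eq_finrank_of_le_of_mul_finrank_eq` —, and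
  for Hodge structures `reducedDegree_endAlg_eq_finrank_of_mul_finrank_eq'` (§3's
  `reducedDegree_endAlg_eq_finrank_of_mul_finrank_eq` with the hypothesis `H.IsPolarizable` removed: the semisimple
  `ℚ[L ∪ R] ⊆ E_φ` replaces `E_φ` in the double-commutant step).

## References

* [MilneCM2006] J. S. Milne, *Complex Multiplication* (2006/2020), Ch. I §3 Exercise 3.10 (a)(b) (p. 29), Def. 3.2,
  Prop. 3.1, Prop. 3.3 (p. 27), Prop. 3.6 (c) (p. 28).
* [Deligne1982HodgeCycles] P. Deligne, *Hodge cycles on abelian varieties* (LNM 900, 1982), I §5 (CM-type Hodge structures).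
* [GreenGriffithsKerr2012] M. Green, P. Griffiths, M. Kerr, *Mumford–Tate Groups and Domains* (2012), §V.B.
* [Moonen2017FamiliesMotives] B. Moonen, *Families of motives and the Mumford–Tate conjecture* (2017), §2.1 (p. 3)
  (`End` of a polarizable Hodge structure is semisimple; the involution of a polarization).
* [Huybrechts2016K3] D. Huybrechts, *Lectures on K3 Surfaces* (2016), §3.3.5 eq. (3.3), Lemma 3.3.12.
* [Cimpric2008FormallyRealInvolutions] J. Cimprič, Comm. Algebra 36 (2008) 165–178, §2 Lemma 5.
* [Voight2021] J. Voight, *Quaternion Algebras*, §7.7 Prop. 7.7.8; [BourbakiAlgebreVIII2012] VIII §14 n°7 Prop. 4, Cor. 1.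
* [Pierce1982] R. S. Pierce, *Associative Algebras* (GTM 88, 1982), §10.5 Prop. c and Corollary (tensor products of separable
  algebras).
* [Zarhin2018SuperellipticJacobians] Yu. G. Zarhin, §4 Thm. 4.1 (double centralizer for semisimple subalgebras; the tree's
  `centralizer_centralizer_eq_of_isSemisimpleRing`).
-/

noncomputable section

open Module

namespace Literature.AlgebraicGeometry.Motives

namespace HodgeStructure

open Literature.RingTheory.CentralSimple

universe u

/-! ## §0 Plumbing -/

section Plumbing

variable {F : Type*} [Field F] {W : Type*} [AddCommGroup W] [Module F W]

/-- A simple subalgebra of `End_F(W)` forces `W ≠ 0`. [folklore] -/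
private theorem nontrivial_of_isSimpleRing_le_end (L : Subalgebra F (Module.End F W)) [IsSimpleRing L] :
    Nontrivial W := by
  obtain ⟨x, y, hxy⟩ := exists_pair_ne ↥L
  by_contra h
  haveI : Subsingleton W := not_nontrivial_iff_subsingleton.1 h
  exact hxy (Subtype.ext (LinearMap.ext fun v => Subsingleton.elim _ _))

/-- `End_F(W)` is simple for `W ≠ 0`. [folklore] -/
private theorem isSimpleRing_moduleEnd₆₂ [FiniteDimensional F W] [Nontrivial W] : IsSimpleRing (Module.End F W) := by
  have hn : 0 < finrank F W := finrank_pos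
  haveI : Nonempty (Fin (finrank F W)) := ⟨⟨0, hn⟩⟩
  exact IsSimpleRing.of_ringEquiv (LinearMap.toMatrixAlgEquiv (Module.finBasis F W)).symm.toRingEquiv inferInstance

/-- A subalgebra is reduced iff it contains no non-zero nilpotent element of the ambient algebra. [folklore] -/
private theorem isReduced_subalgebra_iff₇ {R : Type*} [CommSemiring R] {X : Type*} [Semiring X] [Algebra R X]
    (S : Subalgebra R X) : IsReduced S ↔ ∀ x ∈ S, IsNilpotent x → x = 0 := by
  constructor
  · rintro h x hx ⟨m, hm⟩
    have h0 : (⟨x, hx⟩ : S) = 0 :=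
      h.eq_zero _ ⟨m, Subtype.ext (by rw [SubmonoidClass.coe_pow, ZeroMemClass.coe_zero]; exact hm)⟩
    exact congrArg Subtype.val h0
  · intro h
    refine ⟨fun x hx => ?_⟩
    obtain ⟨m, hm⟩ := hx
    exact Subtype.ext (h x x.2 ⟨m, by rw [← SubmonoidClass.coe_pow, hm]; rfl⟩)

/-- The commutant of a union is the intersection of the commutants. [folklore] -/
private theorem centralizer_union_eq_inf {R : Type*} [CommSemiring R] {X : Type*} [Semiring X] [Algebra R X]
    (s t : Set X) : Subalgebra.centralizer R (s ∪ t) = Subalgebra.centralizer R s ⊓ Subalgebra.centralizer R t := by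
  ext x
  rw [Algebra.mem_inf, Subalgebra.mem_centralizer_iff, Subalgebra.mem_centralizer_iff, Subalgebra.mem_centralizer_iff]
  constructor
  · intro hx
    exact ⟨fun g hg => hx g (Set.mem_union_left _ hg), fun g hg => hx g (Set.mem_union_right _ hg)⟩
  · rintro ⟨h1, h2⟩ g (hg | hg)
    · exact h1 g hg
    · exact h2 g hg

end Plumbing

/-- A polarization of a weight-`n` Hodge structure is `(-1)ⁿ`-symmetric, in the shape `ψ(v, w) = ε · ψ(w, v)` (the field
`Polarization.flip_form`, elementwise). [cite: VoisinHodgeI2002, §7.1.2] -/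
private theorem form_eq_eps_mul_form_swap' {V : Type u} [AddCommGroup V] [Module ℚ V] {n : ℤ} {H : HodgeStructure V n}
    (ψ : H.Polarization) (v w : V) : ψ.form v w = (((n.negOnePow : ℤˣ) : ℤ) : ℚ) * ψ.form w v := by
  have h : ψ.form v w = ((n.negOnePow : ℤˣ) : ℤ) • ψ.form w v := LinearMap.congr_fun₂ ψ.flip_form w v
  rw [h, zsmul_eq_mul]

variable {V : Type u} [AddCommGroup V] [Module ℚ V] [Module.Finite ℚ V] {n : ℤ} (H : HodgeStructure V n)
  (L : Subalgebra ℚ (Module.End ℚ V)) [IsSimpleRing L] {d : ℕ}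

/-! ## §1 The bound `d · [E_φ ⊓ C(L) : ℚ]_red ≤ dim V` -/

/-- **EX. 3.10 (a), FIRST CLAUSE, for Hodge structures: `d · [E_φ ⊓ C(L) : ℚ]_red ≤ dim_ℚ V`** — every commutative
reduced `R ⊆ E_φ` commuting with the simple `L` (degree `d` over its centre) has `d · dim_ℚ R ≤ dim V` (the tree's
`End.mul_finrank_le_finrank_of_le_centralizer`), applied to an `R` of the top dimension `[E_φ ⊓ C(L)]_red`.
[cite: MilneCM2006, Ch. I §3 Exercise 3.10 (a) (p. 29)] [cite: Voight2021, §7.7 Prop. 7.7.8] -/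
theorem mul_reducedDegree_endAlg_inf_centralizer_le_finrank
    (hd : finrank ℚ L = d ^ 2 * finrank ℚ ↥(Subalgebra.center ℚ ↥L)) :
    d * reducedDegree ℚ ↥(H.endAlg ⊓ Subalgebra.centralizer ℚ (L : Set (Module.End ℚ V))) ≤ finrank ℚ V := by
  haveI : Nontrivial V := nontrivial_of_isSimpleRing_le_end L
  set T : Subalgebra ℚ (Module.End ℚ V) := H.endAlg ⊓ Subalgebra.centralizer ℚ (L : Set (Module.End ℚ V)) with hTdef
  obtain ⟨R', hR'comm, hR'red, hR'dim⟩ := exists_finrank_eq_reducedDegree (F := ℚ) (B := ↥T)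
  haveI := hR'red
  let e := Subalgebra.equivMapOfInjective R' T.val Subtype.val_injective
  haveI : IsReduced ↥(R'.map T.val) := isReduced_of_injective e.symm e.symm.injective
  have hcomm : ∀ x ∈ R'.map T.val, ∀ y ∈ R'.map T.val, x * y = y * x := by
    rintro _ ⟨a, ha, rfl⟩ _ ⟨b, hb, rfl⟩
    rw [← map_mul, ← map_mul, hR'comm a ha b hb]
  have hle : R'.map T.val ≤ Subalgebra.centralizer ℚ (L : Set (Module.End ℚ V)) := by
    rintro _ ⟨x, -, rfl⟩
    exact (Algebra.mem_inf.1 x.2).2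
  have h := End.mul_finrank_le_finrank_of_le_centralizer L hd (R'.map T.val) hcomm hle
  rwa [← e.toLinearEquiv.finrank_eq, hR'dim] at h

/-! ## §2 CM ⟹ equality -/

/-- The commutant `Z = C_B(E_φ)` of the endomorphism algebra of a CM Hodge structure (`[E_φ : ℚ]_red = dim V`) is
commutative and reduced: it lies inside any commutative reduced `T ⊆ E_φ` with `dim T = dim V`, which is its own
commutant in `End_ℚ(V)`. [cite: MilneCM2006, Ch. I §3 Prop. 3.3 (b) ⟹ (c) (p. 27) and proof of Prop. 3.6] -/
theorem centralizer_endAlg_comm_isReduced_of_reducedDegree_eq (hCM : reducedDegree ℚ ↥H.endAlg = finrank ℚ V) :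
    (∀ x ∈ Subalgebra.centralizer ℚ (H.endAlg : Set (Module.End ℚ V)),
        ∀ y ∈ Subalgebra.centralizer ℚ (H.endAlg : Set (Module.End ℚ V)), x * y = y * x) ∧
      IsReduced ↥(Subalgebra.centralizer ℚ (H.endAlg : Set (Module.End ℚ V))) := by
  haveI : Module.Finite ℚ ↥H.endAlg := finite_endAlg H
  obtain ⟨T₀, hT₀comm, hT₀red, hT₀dim⟩ :=
    (reducedDegree_eq_iff_exists_of_le (reducedDegree_endAlg_le_finrank H)).1 hCM
  haveI := hT₀red
  -- `T = T₀ ⊆ E_φ ⊆ B`, commutative reduced of dimension `dim V`, hence `C_B(T) = T`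
  set T : Subalgebra ℚ (Module.End ℚ V) := T₀.map H.endAlg.val with hTdef
  let e := Subalgebra.equivMapOfInjective T₀ H.endAlg.val Subtype.val_injective
  have hTred : IsReduced ↥T := isReduced_of_injective e.symm e.symm.injective
  have hTcomm : ∀ x ∈ T, ∀ y ∈ T, x * y = y * x := by
    rintro _ ⟨a, ha, rfl⟩ _ ⟨b, hb, rfl⟩
    rw [← map_mul, ← map_mul, hT₀comm a ha b hb]
  have hTE : T ≤ H.endAlg := by
    rintro _ ⟨x, -, rfl⟩
    exact x.2
  have hTdim : finrank ℚ ↥T = finrank ℚ V := by rw [← e.toLinearEquiv.finrank_eq, hT₀dim]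
  have hTT : Subalgebra.centralizer ℚ (T : Set (Module.End ℚ V)) = T :=
    Literature.RingTheory.SimpleModule.Commutant.centralizer_eq_self_of_comm_isReduced_finrank_eq T hTcomm hTred hTdim
  have hZT : Subalgebra.centralizer ℚ (H.endAlg : Set (Module.End ℚ V)) ≤ T := by
    rw [← hTT]
    exact Subalgebra.centralizer_le ℚ _ _ (fun x hx => hTE hx)
  refine ⟨fun x hx y hy => hTcomm x (hZT hx) y (hZT hy), ?_⟩
  rw [isReduced_subalgebra_iff₇] at hTred ⊢
  exact fun x hx hn' => hTred x (hZT hx) hn'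

/-- **EX. 3.10 (a): «equality holds for some `R` if `A` has complex multiplication», in reduced-degree form, for a
polarizable Hodge structure: `[E_φ]_red = dim V` ⟹ `d · [E_φ ⊓ C(L) : ℚ]_red = dim V`** (`L ≤ E_φ` simple of degree `d`
over its centre).  With `Z = C_B(E_φ)` commutative reduced and `L ⊆ C_B(Z)`, FILE 1 (B2) gives
`d · [C_B(Z ∪ L)]_red = dim V`, and `C_B(Z ∪ L) = C_B(Z) ⊓ C_B(L) = E_φ ⊓ C_B(L)` by the bicommutant theorem for the
semisimple `E_φ`. [cite: MilneCM2006, Ch. I §3 Exercise 3.10 (a) (p. 29)] [cite: Moonen2017FamiliesMotives, §2.1 (p. 3)]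
[cite: BourbakiAlgebreVIII2012, VIII §14 n°7 Cor. 1 (p. A VIII.260)] -/
theorem mul_reducedDegree_endAlg_inf_centralizer_eq_finrank (hH : H.IsPolarizable)
    (hCM : reducedDegree ℚ ↥H.endAlg = finrank ℚ V) (hLE : L ≤ H.endAlg)
    (hd : finrank ℚ L = d ^ 2 * finrank ℚ ↥(Subalgebra.center ℚ ↥L)) :
    d * reducedDegree ℚ ↥(H.endAlg ⊓ Subalgebra.centralizer ℚ (L : Set (Module.End ℚ V))) = finrank ℚ V := by
  haveI : Nontrivial V := nontrivial_of_isSimpleRing_le_end L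
  haveI : IsSimpleRing (Module.End ℚ V) := isSimpleRing_moduleEnd₆₂
  haveI : IsSemisimpleRing ↥H.endAlg := isSemisimpleRing_endAlg hH
  have hn : finrank ℚ (Module.End ℚ V) = finrank ℚ V ^ 2 := by rw [Module.finrank_linearMap, sq]
  set Z : Subalgebra ℚ (Module.End ℚ V) := Subalgebra.centralizer ℚ (H.endAlg : Set (Module.End ℚ V)) with hZdef
  obtain ⟨hZcomm, hZred⟩ := centralizer_endAlg_comm_isReduced_of_reducedDegree_eq H hCM
  haveI := hZred
  have hLZ : L ≤ Subalgebra.centralizer ℚ (Z : Set (Module.End ℚ V)) := fun l hl ↦ by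
    rw [Subalgebra.mem_centralizer_iff]
    intro z hz
    exact ((Subalgebra.mem_centralizer_iff ℚ).1 hz l (hLE hl)).symm
  have hB2 := mul_reducedDegree_centralizer_union_eq hn Z hZcomm L hLZ hd
  have hZZ : Subalgebra.centralizer ℚ (Z : Set (Module.End ℚ V)) = H.endAlg :=
    centralizer_centralizer_eq_of_isSemisimpleRing H.endAlg
  have heq : Subalgebra.centralizer ℚ ((Z : Set (Module.End ℚ V)) ∪ (L : Set (Module.End ℚ V))) =
      H.endAlg ⊓ Subalgebra.centralizer ℚ (L : Set (Module.End ℚ V)) := by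
    rw [centralizer_union_eq_inf, hZZ]
  rw [reducedDegree_eq_of_algEquiv (Subalgebra.equivOfEq _ _ heq)] at hB2
  exact hB2

/-- **EX. 3.10 (a): CM ⟹ «equality holds for some `R`»** — `E_φ ⊓ C(L)` contains a commutative reduced `R` with
`d · dim_ℚ R = dim V`. [cite: MilneCM2006, Ch. I §3 Exercise 3.10 (a) (p. 29)] -/
theorem exists_le_endAlg_inf_centralizer_mul_finrank_eq_finrank (hH : H.IsPolarizable)
    (hCM : reducedDegree ℚ ↥H.endAlg = finrank ℚ V) (hLE : L ≤ H.endAlg)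
    (hd : finrank ℚ L = d ^ 2 * finrank ℚ ↥(Subalgebra.center ℚ ↥L)) :
    ∃ R : Subalgebra ℚ (Module.End ℚ V), R ≤ H.endAlg ⊓ Subalgebra.centralizer ℚ (L : Set (Module.End ℚ V)) ∧
      (∀ x ∈ R, ∀ y ∈ R, x * y = y * x) ∧ IsReduced R ∧ d * finrank ℚ R = finrank ℚ V := by
  set T : Subalgebra ℚ (Module.End ℚ V) := H.endAlg ⊓ Subalgebra.centralizer ℚ (L : Set (Module.End ℚ V)) with hTdef
  have hT := mul_reducedDegree_endAlg_inf_centralizer_eq_finrank H L hH hCM hLE hd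
  obtain ⟨R', hR'comm, hR'red, hR'dim⟩ := exists_finrank_eq_reducedDegree (F := ℚ) (B := ↥T)
  haveI := hR'red
  let e := Subalgebra.equivMapOfInjective R' T.val Subtype.val_injective
  refine ⟨R'.map T.val, ?_, ?_, isReduced_of_injective e.symm e.symm.injective, ?_⟩
  · rintro _ ⟨x, -, rfl⟩
    exact x.2
  · rintro _ ⟨a, ha, rfl⟩ _ ⟨b, hb, rfl⟩
    rw [← map_mul, ← map_mul, hR'comm a ha b hb]
  · rw [← hT, ← hR'dim, ← e.toLinearEquiv.finrank_eq]

/-! ## §3 Equality for some `R` ⟹ CM -/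

/-- **EX. 3.10 (a): «equality holds for some `R` ONLY IF `A` has complex multiplication», for a polarizable Hodge
structure**: a commutative reduced `R ⊆ E_φ ⊓ C(L)` with `d · dim_ℚ R = dim V` forces `[E_φ : ℚ]_red = dim V` — FILE 1
(B3) makes `Z = C_B(E_φ) ⊆ C_B(R ∪ L) = R` commutative (and reduced), so `[E_φ]_red = [C_B(Z)]_red = [B]_red = dim V`
(bicommutant for the semisimple `E_φ`; `reducedDegree_centralizer_eq_of_comm`).
[cite: MilneCM2006, Ch. I §3 Exercise 3.10 (a) (p. 29), Prop. 3.3 (p. 27)] [cite: BourbakiAlgebreVIII2012, VIII §14 n°7 Prop. 4 a) (p. A VIII.260)] -/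
theorem reducedDegree_endAlg_eq_finrank_of_mul_finrank_eq (hH : H.IsPolarizable) (hLE : L ≤ H.endAlg)
    (hd : finrank ℚ L = d ^ 2 * finrank ℚ ↥(Subalgebra.center ℚ ↥L)) (R : Subalgebra ℚ (Module.End ℚ V))
    (hRcomm : ∀ x ∈ R, ∀ y ∈ R, x * y = y * x) [hRred : IsReduced R]
    (hRle : R ≤ H.endAlg ⊓ Subalgebra.centralizer ℚ (L : Set (Module.End ℚ V))) (hR : d * finrank ℚ R = finrank ℚ V) :
    reducedDegree ℚ ↥H.endAlg = finrank ℚ V := by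
  haveI : Nontrivial V := nontrivial_of_isSimpleRing_le_end L
  haveI : IsSimpleRing (Module.End ℚ V) := isSimpleRing_moduleEnd₆₂
  haveI : IsSemisimpleRing ↥H.endAlg := isSemisimpleRing_endAlg hH
  have hn : finrank ℚ (Module.End ℚ V) = finrank ℚ V ^ 2 := by rw [Module.finrank_linearMap, sq]
  have hRL : R ≤ Subalgebra.centralizer ℚ (L : Set (Module.End ℚ V)) := fun x hx ↦ (Algebra.mem_inf.1 (hRle hx)).2
  have hRE : R ≤ H.endAlg := fun x hx ↦ (Algebra.mem_inf.1 (hRle hx)).1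
  obtain ⟨hZR, hZcomm⟩ := centralizer_comm_of_mul_finrank_eq hn L hd R hRcomm hRL hR H.endAlg hLE hRE
  set Z : Subalgebra ℚ (Module.End ℚ V) := Subalgebra.centralizer ℚ (H.endAlg : Set (Module.End ℚ V)) with hZdef
  haveI : IsReduced ↥Z := by
    rw [isReduced_subalgebra_iff₇] at hRred ⊢
    exact fun x hx hn' => hRred x (hZR hx) hn'
  have hZZ : Subalgebra.centralizer ℚ (Z : Set (Module.End ℚ V)) = H.endAlg :=
    centralizer_centralizer_eq_of_isSemisimpleRing H.endAlg
  rw [← reducedDegree_eq_of_algEquiv (Subalgebra.equivOfEq _ _ hZZ), reducedDegree_centralizer_eq_of_comm Z hZcomm,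
    reducedDegree_moduleEnd]

/-- **EX. 3.10 (a) FOR POLARIZABLE HODGE STRUCTURES, as an equivalence**: `E_φ ⊓ C(L)` contains a commutative reduced `R`
with `d · dim_ℚ R = dim V` iff `[E_φ : ℚ]_red = dim V`. [cite: MilneCM2006, Ch. I §3 Exercise 3.10 (a) (p. 29), Def. 3.2 (p. 27)] -/
theorem exists_mul_finrank_eq_finrank_iff_reducedDegree_endAlg_eq (hH : H.IsPolarizable) (hLE : L ≤ H.endAlg)
    (hd : finrank ℚ L = d ^ 2 * finrank ℚ ↥(Subalgebra.center ℚ ↥L)) :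
    (∃ R : Subalgebra ℚ (Module.End ℚ V), R ≤ H.endAlg ⊓ Subalgebra.centralizer ℚ (L : Set (Module.End ℚ V)) ∧
      (∀ x ∈ R, ∀ y ∈ R, x * y = y * x) ∧ IsReduced R ∧ d * finrank ℚ R = finrank ℚ V) ↔
      reducedDegree ℚ ↥H.endAlg = finrank ℚ V := by
  constructor
  · rintro ⟨R, hRle, hRcomm, hRred, hR⟩
    exact reducedDegree_endAlg_eq_finrank_of_mul_finrank_eq H L hH hLE hd R hRcomm hRle hR
  · exact fun h ↦ exists_le_endAlg_inf_centralizer_mul_finrank_eq_finrank H L hH h hLE hd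

/-! ## §4 Exercise 3.10 (b): an `R` stable under the involution of a polarization -/

/-- ★★★ **MILNE CM EX. 3.10 (b) FOR A POLARIZED HODGE STRUCTURE: «Let `′` be a Rosati involution on `End⁰(A)`
stabilizing `L`; show that, if `A` has complex multiplication, then there is an `R` as in (a) that is stabilized by
`′`.»**  For a polarization `ψ` of `H` with adjoint involution `a ↦ a†` (`ψ(a v, w) = ψ(v, a† w)`), `[E_φ : ℚ]_red = dim V`,
and a simple `L ≤ E_φ` of degree `d` over its centre with `L† = L`: there is a commutative reduced `R ≤ E_φ ⊓ C(L)`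
with `d · dim_ℚ R = dim V` and `R† = R`. [cite: MilneCM2006, Ch. I §3 Exercise 3.10 (b) (p. 29)]
[cite: Cimpric2008FormallyRealInvolutions, §2 Lemma 5] [cite: Huybrechts2016K3, §3.3.5 eq. (3.3) and Lemma 3.3.12] -/
theorem exists_adjoint_stable_le_endAlg_inf_centralizer_mul_finrank_eq_finrank (ψ : H.Polarization)
    (hCM : reducedDegree ℚ ↥H.endAlg = finrank ℚ V) (hLE : L ≤ H.endAlg)
    (hd : finrank ℚ L = d ^ 2 * finrank ℚ ↥(Subalgebra.center ℚ ↥L)) (hLψ : ∀ a ∈ L, ψ.adjoint a ∈ L) :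
    ∃ R : Subalgebra ℚ (Module.End ℚ V), R ≤ H.endAlg ⊓ Subalgebra.centralizer ℚ (L : Set (Module.End ℚ V)) ∧
      (∀ x ∈ R, ∀ y ∈ R, x * y = y * x) ∧ IsReduced R ∧ d * finrank ℚ R = finrank ℚ V ∧
      ∀ a ∈ R, ψ.adjoint a ∈ R := by
  haveI : Nontrivial V := nontrivial_of_isSimpleRing_le_end L
  haveI : IsSimpleRing (Module.End ℚ V) := isSimpleRing_moduleEnd₆₂
  haveI : IsSemisimpleRing ↥H.endAlg := isSemisimpleRing_endAlg ⟨ψ⟩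
  -- `Z = C_B(E_φ)`: commutative, reduced; `C_B(Z) = E_φ`
  set Z : Subalgebra ℚ (Module.End ℚ V) := Subalgebra.centralizer ℚ (H.endAlg : Set (Module.End ℚ V)) with hZdef
  obtain ⟨hZcomm, hZred⟩ := centralizer_endAlg_comm_isReduced_of_reducedDegree_eq H hCM
  haveI := hZred
  have hZZ : Subalgebra.centralizer ℚ (Z : Set (Module.End ℚ V)) = H.endAlg :=
    centralizer_centralizer_eq_of_isSemisimpleRing H.endAlg
  have hLZ : ∀ l ∈ L, ∀ z ∈ Z, l * z = z * l := fun l hl z hz ↦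
    (Subalgebra.mem_centralizer_iff ℚ).1 hz l (hLE hl)
  -- the adjoint as a `ℚ`-linear anti-involution `σ`
  let σ : Module.End ℚ V →ₗ[ℚ] Module.End ℚ V :=
    { toFun := ψ.adjoint, map_add' := ψ.adjoint_add, map_smul' := ψ.adjoint_smul }
  have hσ : ∀ x, σ x = ψ.adjoint x := fun _ ↦ rfl
  have hσmul : ∀ x y, σ (x * y) = σ y * σ x := fun x y ↦ ψ.adjoint_mul x y
  have hσσ : ∀ x, σ (σ x) = x := fun x ↦ ψ.adjoint_adjoint x
  have hEσ : ∀ y ∈ H.endAlg, σ y ∈ H.endAlg := fun y hy ↦ ψ.adjoint_mem_endAlg hy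
  have hZσ : ∀ z ∈ Z, σ z ∈ Z := AntiInvolution.centralizer_stable σ hσmul hσσ hEσ
  have hLσ : ∀ y ∈ L, σ y ∈ L := hLψ
  -- `S = ℚ[L ∪ Z]`: `σ`-stable and semisimple
  set S : Subalgebra ℚ (Module.End ℚ V) :=
    Algebra.adjoin ℚ ((L : Set (Module.End ℚ V)) ∪ (Z : Set (Module.End ℚ V))) with hSdef
  have hLS : L ≤ S := fun x hx ↦ Algebra.subset_adjoin (Or.inl hx)
  have hZS : Z ≤ S := fun x hx ↦ Algebra.subset_adjoin (Or.inr hx)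
  have hSσ : ∀ a ∈ S, σ a ∈ S := by
    refine AntiInvolution.adjoin_stable σ hσmul hσσ ?_
    rintro x (hx | hx)
    · exact Algebra.subset_adjoin (Or.inl (hLσ x hx))
    · exact Algebra.subset_adjoin (Or.inr (hZσ x hx))
  haveI : IsSemisimpleRing ↥L := by
    haveI : IsArtinianRing ↥L := IsArtinianRing.of_finite ℚ _
    infer_instance
  haveI : IsSemisimpleRing ↥S :=
    Literature.NumberTheory.ComplexMultiplication.isSemisimpleRing_adjoin_union_of_comm_isReduced L Z hZcomm hLZ
  have hcommS : ∀ y : Module.End ℚ V, (∀ l ∈ L, y * l = l * y) → (∀ z ∈ Z, y * z = z * y) →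
      ∀ c ∈ S, y * c = c * y := by
    intro y hyL hyZ c hc
    refine (Algebra.commute_of_mem_adjoin_of_forall_mem_commute hc ?_).eq
    rintro b (hb | hb)
    · exact hyL b hb
    · exact hyZ b hb
  -- A3-G147 FILE 2 on the semisimple `S`-module `V` with the non-degenerate `(-1)ⁿ`-symmetric `ψ`, `S` acting by
  -- `σ`-adjointable operators: a `σ`-stable commutative reduced `R ⊆ End_S(V) = C_B(S)`, maximal commutative there
  obtain ⟨R, hRS, hRcomm, hRred, hRmax, hRadj⟩ :=
    Literature.RingTheory.SimpleModule.Commutant.exists_subalgebra_comm_reduced_maximal_adjoint_stable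
      (F := ℚ) (S := ↥S) (V := V) ψ.form two_ne_zero ψ.nondegenerate (form_eq_eps_mul_form_swap' ψ)
      (fun s ↦ ⟨⟨σ s, hSσ _ s.2⟩, fun v w ↦ by
        show ψ.form ((s : Module.End ℚ V) v) w = ψ.form v (ψ.adjoint (s : Module.End ℚ V) w)
        exact ψ.isAdjointPair_adjoint _ v w⟩)
  haveI := hRred
  have hRS' : ∀ x ∈ R, ∀ c ∈ S, x * c = c * x := fun x hx c hc ↦ LinearMap.ext fun v ↦ by
    show x (c v) = c (x v)
    exact hRS x hx ⟨c, hc⟩ v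
  have hRmax' : ∀ f : Module.End ℚ V, (∀ c ∈ S, f * c = c * f) → (∀ x ∈ R, f * x = x * f) → f ∈ R :=
    fun f hf hfR ↦ hRmax f (fun c v ↦ by
      show f ((c : Module.End ℚ V) v) = (c : Module.End ℚ V) (f v)
      rw [← Module.End.mul_apply, hf c c.2, Module.End.mul_apply]) hfR
  have hRσ : ∀ x ∈ R, σ x ∈ R := by
    intro x hx
    obtain ⟨y, hy, hxy⟩ := hRadj x hx
    have hyx : y = ψ.adjoint x := ψ.eq_adjoint_of_isAdjointPair hxy
    rw [hσ, ← hyx]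
    exact hy
  -- `R ⊆ C_B(S) ⊆ C_B(Z) = E_φ`; `Z ⊆ R` by maximality; an element of `C_B(L)` commuting with `R` lies in `R`
  have hRE : R ≤ H.endAlg := by
    intro x hx
    rw [← hZZ, Subalgebra.mem_centralizer_iff]
    exact fun z hz ↦ (hRS' x hx z (hZS hz)).symm
  have hRle : R ≤ H.endAlg ⊓ Subalgebra.centralizer ℚ (L : Set (Module.End ℚ V)) := fun x hx ↦
    Algebra.mem_inf.2 ⟨hRE hx, (Subalgebra.mem_centralizer_iff ℚ).2 fun l hl ↦ (hRS' x hx l (hLS hl)).symm⟩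
  have hZR : Z ≤ R := fun z hz ↦
    hRmax' z (hcommS z (fun l hl ↦ (hLZ l hl z hz).symm) (fun z' hz' ↦ hZcomm z hz z' hz'))
      (fun t ht ↦ (hRS' t ht z (hZS hz)).symm)
  have hmaxR : ∀ y ∈ Subalgebra.centralizer ℚ (L : Set (Module.End ℚ V)), (∀ t ∈ R, y * t = t * y) → y ∈ R :=
    fun y hy hyT ↦ hRmax' y (hcommS y (fun l hl ↦ ((Subalgebra.mem_centralizer_iff ℚ).1 hy l hl).symm)
      (fun z hz ↦ hyT z (hZR hz))) hyT
  -- DIMENSION: `R` is a maximal étale subalgebra of the SIMPLE `C_B(L)`: `d · dim R = d · [C_B(L)]_red = dim V`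
  have hRdim : d * finrank ℚ R = finrank ℚ V := by
    set C : Subalgebra ℚ (Module.End ℚ V) := Subalgebra.centralizer ℚ (L : Set (Module.End ℚ V)) with hCdef
    haveI : IsSimpleRing ↥C := isSimpleRing_centralizer L
    have hRC : R ≤ C := fun y hy ↦ (Algebra.mem_inf.1 (hRle hy)).2
    set R' : Subalgebra ℚ ↥C := R.comap C.val with hR'def
    have hmem : ∀ x : ↥C, x ∈ R' ↔ (x : Module.End ℚ V) ∈ R := fun x ↦ Subalgebra.mem_comap _ _ _
    have hR'comm : ∀ x ∈ R', ∀ y ∈ R', x * y = y * x := fun x hx y hy ↦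
      Subtype.ext (hRcomm _ ((hmem x).1 hx) _ ((hmem y).1 hy))
    have hRred' := (isReduced_subalgebra_iff₇ R).1 hRred
    have hR'red : IsReduced ↥R' := by
      rw [isReduced_subalgebra_iff₇]
      intro x hx hn'
      obtain ⟨m, hm⟩ := hn'
      exact Subtype.ext (hRred' _ ((hmem x).1 hx) ⟨m, by rw [← SubmonoidClass.coe_pow, hm]; rfl⟩)
    have hdim : finrank ℚ ↥R' = finrank ℚ R := by
      let φ : ↥R' →ₗ[ℚ] ↥R :=
        { toFun := fun x => ⟨((x : ↥C) : Module.End ℚ V), (hmem x).1 x.2⟩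
          map_add' := fun x y => rfl
          map_smul' := fun r x => rfl }
      have hφ : Function.Bijective φ := by
        constructor
        · intro x y hxy
          exact Subtype.ext (Subtype.ext (congrArg (fun z : ↥R => (z : Module.End ℚ V)) hxy))
        · intro y
          exact ⟨⟨⟨(y : Module.End ℚ V), hRC y.2⟩, (hmem _).2 y.2⟩, rfl⟩
      exact (LinearEquiv.ofBijective φ hφ).finrank_eq
    have hmax : Maximal (fun S' : Subalgebra ℚ ↥C => (∀ x ∈ S', ∀ y ∈ S', x * y = y * x) ∧ IsReduced S') R' := by
      refine ⟨⟨hR'comm, hR'red⟩, fun S' hS' hR'S' y hy ↦ ?_⟩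
      rw [hmem]
      refine hmaxR (y : Module.End ℚ V) y.2 fun t ht ↦ ?_
      have h := hS'.1 y hy ⟨t, hRC ht⟩ (hR'S' ((hmem ⟨t, hRC ht⟩).2 ht))
      exact congrArg (fun z : ↥C ↦ (z : Module.End ℚ V)) h
    have h1 := (finrank_eq_reducedDegree_and_center_le_of_maximal_of_isSimpleRing R' hmax).1
    have h2 := End.mul_reducedDegree_centralizer_eq_finrank L hd
    rw [← hdim, h1, h2]
  refine ⟨R, hRle, hRcomm, hRred, hRdim, fun a ha ↦ ?_⟩
  rw [← hσ]
  exact hRσ a ha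

/-- ★ **EX. 3.10 (a) + (b) AS AN EQUIVALENCE for a polarized Hodge structure and an `L` with `L† = L`**:
`[E_φ : ℚ]_red = dim V` iff `E_φ ⊓ C(L)` contains a `†`-STABLE commutative reduced `R` with `d · dim_ℚ R = dim V`.
[cite: MilneCM2006, Ch. I §3 Exercise 3.10 (a)(b) (p. 29)] -/
theorem exists_adjoint_stable_mul_finrank_eq_finrank_iff_reducedDegree_endAlg_eq (ψ : H.Polarization) (hLE : L ≤ H.endAlg)
    (hd : finrank ℚ L = d ^ 2 * finrank ℚ ↥(Subalgebra.center ℚ ↥L)) (hLψ : ∀ a ∈ L, ψ.adjoint a ∈ L) :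
    (∃ R : Subalgebra ℚ (Module.End ℚ V), R ≤ H.endAlg ⊓ Subalgebra.centralizer ℚ (L : Set (Module.End ℚ V)) ∧
      (∀ x ∈ R, ∀ y ∈ R, x * y = y * x) ∧ IsReduced R ∧ d * finrank ℚ R = finrank ℚ V ∧
      ∀ a ∈ R, ψ.adjoint a ∈ R) ↔ reducedDegree ℚ ↥H.endAlg = finrank ℚ V := by
  refine ⟨fun ⟨R, hRle, hRcomm, hRred, hR, _⟩ ↦ ?_,
    fun h ↦ exists_adjoint_stable_le_endAlg_inf_centralizer_mul_finrank_eq_finrank H L ψ h hLE hd hLψ⟩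
  haveI := hRred
  exact reducedDegree_endAlg_eq_finrank_of_mul_finrank_eq H L ⟨ψ⟩ hLE hd R hRcomm hRle hR

omit [IsSimpleRing L] L in
/-- ★★ **THE CASE `L = ℚ`: a CM Hodge structure carries, for EVERY polarization `ψ`, a `†`-STABLE commutative reduced
`R ⊆ E_φ` of rank `dim V`** (Milne's Prop. 3.6 (c) «an étale `ℚ`-algebra … invariant under some Rosati involution … of
degree `2 dim A`», Hodge-structure level, any polarization; the CM-algebra refinement is not asserted).
[cite: MilneCM2006, Ch. I §3 Prop. 3.6 (c) (p. 28), Exercise 3.10 (b) (p. 29)] [cite: GreenGriffithsKerr2012, §V.B] -/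
theorem exists_adjoint_stable_le_endAlg_finrank_eq_finrank (ψ : H.Polarization)
    (hCM : reducedDegree ℚ ↥H.endAlg = finrank ℚ V) :
    ∃ R : Subalgebra ℚ (Module.End ℚ V), R ≤ H.endAlg ∧ (∀ x ∈ R, ∀ y ∈ R, x * y = y * x) ∧ IsReduced R ∧
      finrank ℚ R = finrank ℚ V ∧ ∀ a ∈ R, ψ.adjoint a ∈ R := by
  rcases subsingleton_or_nontrivial V with hV | hV
  · -- `V = 0`: `R = ⊥ = 0`
    haveI : Subsingleton (Module.End ℚ V) := ⟨fun f g => LinearMap.ext fun v => Subsingleton.elim _ _⟩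
    refine ⟨⊥, bot_le, fun x _ y _ ↦ Subsingleton.elim _ _, ⟨fun x _ ↦ Subsingleton.elim _ _⟩, ?_, fun a ha ↦ ?_⟩
    · rw [Module.finrank_zero_of_subsingleton, Module.finrank_zero_of_subsingleton (M := V)]
    · rw [Subsingleton.elim (ψ.adjoint a) a]
      exact ha
  · -- `V ≠ 0`: §4 with `L = ℚ · 1` (simple, commutative, `†`-stable)
    haveI : IsSimpleRing ↥(⊥ : Subalgebra ℚ (Module.End ℚ V)) :=
      IsSimpleRing.of_ringEquiv (Algebra.botEquiv ℚ (Module.End ℚ V)).symm.toRingEquiv inferInstance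
    have hc : Subalgebra.center ℚ ↥(⊥ : Subalgebra ℚ (Module.End ℚ V)) = ⊤ :=
      eq_top_iff.2 fun x _ => Subalgebra.mem_center_iff.2 fun y => by
        obtain ⟨q, hq⟩ := Algebra.mem_bot.1 x.2
        apply Subtype.ext
        rw [Subalgebra.coe_mul, Subalgebra.coe_mul, ← hq]
        exact (Algebra.commutes q (y : Module.End ℚ V)).symm
    have hd : finrank ℚ ↥(⊥ : Subalgebra ℚ (Module.End ℚ V)) =
        1 ^ 2 * finrank ℚ ↥(Subalgebra.center ℚ ↥(⊥ : Subalgebra ℚ (Module.End ℚ V))) := by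
      rw [one_pow, one_mul, hc]
      exact (Subalgebra.topEquiv (R := ℚ) (A := ↥(⊥ : Subalgebra ℚ (Module.End ℚ V)))).toLinearEquiv.finrank_eq.symm
    have hLψ : ∀ a ∈ (⊥ : Subalgebra ℚ (Module.End ℚ V)), ψ.adjoint a ∈ (⊥ : Subalgebra ℚ (Module.End ℚ V)) := by
      intro a ha
      obtain ⟨q, rfl⟩ := Algebra.mem_bot.1 ha
      rw [Algebra.algebraMap_eq_smul_one, ψ.adjoint_smul, ψ.adjoint_one]
      exact Subalgebra.smul_mem _ (Subalgebra.one_mem _) q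
    obtain ⟨R, hRle, hRcomm, hRred, hRdim, hRψ⟩ :=
      exists_adjoint_stable_le_endAlg_inf_centralizer_mul_finrank_eq_finrank H ⊥ ψ hCM bot_le hd hLψ
    exact ⟨R, fun x hx ↦ (Algebra.mem_inf.1 (hRle hx)).1, hRcomm, hRred, by rwa [one_mul] at hRdim, hRψ⟩

/-! ## §5 In terms of the Mumford–Tate group (A3-G146 FILE 5: `MT(H)(ℚ)` commutative ⟺ `[E_φ : ℚ]_red = dim V`) -/

section MumfordTate

variable [HodgeTensorFacts.{u, u}]

/-- **EX. 3.10 (b) for a polarized Hodge structure with commutative Mumford–Tate group** (Deligne's CM-type Hodge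
structures): a `†`-stable commutative reduced `R ≤ E_φ ⊓ C(L)` with `d · dim_ℚ R = dim V`.
[cite: MilneCM2006, Ch. I §3 Exercise 3.10 (b) (p. 29), §4 Prop. 4.1 (p. 34)] [cite: Deligne1982HodgeCycles, I §5] -/
theorem exists_adjoint_stable_mul_finrank_eq_finrank_of_mumfordTateGroup_comm (ψ : H.Polarization)
    (hMT : ∀ g ∈ H.mumfordTateGroup, ∀ g' ∈ H.mumfordTateGroup, g * g' = g' * g) (hLE : L ≤ H.endAlg)
    (hd : finrank ℚ L = d ^ 2 * finrank ℚ ↥(Subalgebra.center ℚ ↥L)) (hLψ : ∀ a ∈ L, ψ.adjoint a ∈ L) :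
    ∃ R : Subalgebra ℚ (Module.End ℚ V), R ≤ H.endAlg ⊓ Subalgebra.centralizer ℚ (L : Set (Module.End ℚ V)) ∧
      (∀ x ∈ R, ∀ y ∈ R, x * y = y * x) ∧ IsReduced R ∧ d * finrank ℚ R = finrank ℚ V ∧
      ∀ a ∈ R, ψ.adjoint a ∈ R :=
  exists_adjoint_stable_le_endAlg_inf_centralizer_mul_finrank_eq_finrank H L ψ
    ((mumfordTateGroup_comm_iff_reducedDegree_endAlg_eq H ⟨ψ⟩).1 hMT) hLE hd hLψ

/-- **EX. 3.10 (a)+(b) ⟺ `MT(H)(ℚ)` commutative**, for a polarized Hodge structure and an `L` with `L† = L`.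
[cite: MilneCM2006, Ch. I §3 Exercise 3.10 (a)(b) (p. 29), §4 Prop. 4.1 (p. 34)] [cite: Deligne1982HodgeCycles, I §5 and Prop. 5.1] -/
theorem exists_adjoint_stable_mul_finrank_eq_finrank_iff_mumfordTateGroup_comm (ψ : H.Polarization)
    (hLE : L ≤ H.endAlg) (hd : finrank ℚ L = d ^ 2 * finrank ℚ ↥(Subalgebra.center ℚ ↥L))
    (hLψ : ∀ a ∈ L, ψ.adjoint a ∈ L) :
    (∃ R : Subalgebra ℚ (Module.End ℚ V), R ≤ H.endAlg ⊓ Subalgebra.centralizer ℚ (L : Set (Module.End ℚ V)) ∧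
      (∀ x ∈ R, ∀ y ∈ R, x * y = y * x) ∧ IsReduced R ∧ d * finrank ℚ R = finrank ℚ V ∧
      ∀ a ∈ R, ψ.adjoint a ∈ R) ↔
      ∀ g ∈ H.mumfordTateGroup, ∀ g' ∈ H.mumfordTateGroup, g * g' = g' * g := by
  rw [mumfordTateGroup_comm_iff_reducedDegree_endAlg_eq H ⟨ψ⟩]
  exact exists_adjoint_stable_mul_finrank_eq_finrank_iff_reducedDegree_endAlg_eq H L ψ hLE hd hLψ

end MumfordTate

/-! ## §5 Equality for some `R` ⟹ CM WITHOUT polarizability: `F[L ∪ R]` is semisimple with commutant `R` -/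

section NoPolarization

variable {F : Type*} [Field F] [CharZero F] {W : Type*} [AddCommGroup W] [Module F W] [FiniteDimensional F W]
  (L₀ : Subalgebra F (Module.End F W)) [IsSimpleRing L₀] {d₀ : ℕ}

omit [CharZero F] [FiniteDimensional F W] [IsSimpleRing L₀] in
/-- A commutative `R` commuting with `L` commutes with `F[L ∪ R]`. [cite: BourbakiAlgebreVIII2012, VIII §1 n°3 (commutant of a generating set)] -/
theorem le_centralizer_adjoin_union_of_le_centralizer (R₀ : Subalgebra F (Module.End F W))
    (hRcomm : ∀ x ∈ R₀, ∀ y ∈ R₀, x * y = y * x) (hRL : R₀ ≤ Subalgebra.centralizer F (L₀ : Set (Module.End F W))) :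
    R₀ ≤ Subalgebra.centralizer F
      ((Algebra.adjoin F ((L₀ : Set (Module.End F W)) ∪ (R₀ : Set (Module.End F W)))) : Set (Module.End F W)) := by
  intro x hx
  refine (Subalgebra.mem_centralizer_iff F).2 fun g hg ↦ ?_
  refine ((Algebra.commute_of_mem_adjoin_of_forall_mem_commute hg ?_).symm).eq
  rintro b (hb | hb)
  · exact (((Subalgebra.mem_centralizer_iff F).1 (hRL hx) b hb) : Commute b x).symm
  · exact hRcomm x hx b hb

omit [CharZero F] [FiniteDimensional F W] [IsSimpleRing L₀] in
/-- `F[L ∪ R] ⊆ E` for every subalgebra `E ⊇ L ∪ R`. [folklore] -/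
private theorem adjoin_union_le_of_le {R₀ E₀ : Subalgebra F (Module.End F W)} (hLE : L₀ ≤ E₀) (hRE : R₀ ≤ E₀) :
    Algebra.adjoin F ((L₀ : Set (Module.End F W)) ∪ (R₀ : Set (Module.End F W))) ≤ E₀ :=
  Algebra.adjoin_le (Set.union_subset (fun _ hx ↦ hLE hx) (fun _ hx ↦ hRE hx))

/-- **`F[L ∪ R]` IS SEMISIMPLE** for a simple finite-dimensional `L ⊆ End_F(W)` and a commutative reduced `R` commuting
with `L` (characteristic `0`): it is a quotient of the semisimple `L ⊗_F R` (A3-G147 FILE 3's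
`isSemisimpleRing_adjoin_union_of_comm_isReduced`). [cite: Pierce1982, §10.5 Prop. c (ii) and Corollary]
[cite: MilneCM2006, Ch. I §3 Exercise 3.10 (a) (p. 29)] -/
theorem isSemisimpleRing_adjoin_union_of_le_centralizer (R₀ : Subalgebra F (Module.End F W))
    (hRcomm : ∀ x ∈ R₀, ∀ y ∈ R₀, x * y = y * x) [IsReduced R₀]
    (hRL : R₀ ≤ Subalgebra.centralizer F (L₀ : Set (Module.End F W))) :
    IsSemisimpleRing ↥(Algebra.adjoin F ((L₀ : Set (Module.End F W)) ∪ (R₀ : Set (Module.End F W)))) := by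
  haveI : IsSemisimpleRing ↥L₀ := by
    haveI : IsArtinianRing ↥L₀ := IsArtinianRing.of_finite F _
    infer_instance
  exact Literature.NumberTheory.ComplexMultiplication.isSemisimpleRing_adjoin_union_of_comm_isReduced L₀ R₀ hRcomm
    fun b hb z hz ↦ (Subalgebra.mem_centralizer_iff F).1 (hRL hz) b hb

/-- **THE COMMUTANT OF `F[L ∪ R]` IS `R`** when `d · dim_F R = dim_F W` ((B3): `C(R ∪ L) = R`, and `R` commutes with
`F[L ∪ R]`). [cite: BourbakiAlgebreVIII2012, VIII §14 n°7 Prop. 4 a) (p. A VIII.260)] [cite: MilneCM2006, Ch. I §3 Exercise 3.10 (a) (p. 29), Prop. 3.3 (c) (p. 27)] -/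
theorem centralizer_adjoin_union_eq_of_mul_finrank_eq (hd : finrank F L₀ = d₀ ^ 2 * finrank F ↥(Subalgebra.center F ↥L₀))
    (R₀ : Subalgebra F (Module.End F W)) (hRcomm : ∀ x ∈ R₀, ∀ y ∈ R₀, x * y = y * x) [IsReduced R₀]
    (hRL : R₀ ≤ Subalgebra.centralizer F (L₀ : Set (Module.End F W))) (hR : d₀ * finrank F R₀ = finrank F W) :
    Subalgebra.centralizer F
        ((Algebra.adjoin F ((L₀ : Set (Module.End F W)) ∪ (R₀ : Set (Module.End F W)))) : Set (Module.End F W)) =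
      R₀ := by
  haveI : Nontrivial W := nontrivial_of_isSimpleRing_le_end L₀
  haveI : IsSimpleRing (Module.End F W) := isSimpleRing_moduleEnd₆₂
  have hn : finrank F (Module.End F W) = finrank F W ^ 2 := by rw [Module.finrank_linearMap, sq]
  set A : Subalgebra F (Module.End F W) := Algebra.adjoin F ((L₀ : Set (Module.End F W)) ∪ (R₀ : Set (Module.End F W)))
  refine le_antisymm ?_ (le_centralizer_adjoin_union_of_le_centralizer L₀ R₀ hRcomm hRL)
  exact (centralizer_comm_of_mul_finrank_eq hn L₀ hd R₀ hRcomm hRL hR A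
    (fun x hx ↦ Algebra.subset_adjoin (Or.inl hx)) (fun x hx ↦ Algebra.subset_adjoin (Or.inr hx))).1

/-- ★ **`F[L ∪ R] = C(R) = End_R(W)`**: with `d · dim_F R = dim_F W`, the algebra generated by the simple `L` and the
commutative reduced `R ⊆ C(L)` is the FULL COMMUTANT of `R` — the double commutant of the semisimple `F[L ∪ R]`
(`centralizer_centralizer_eq_of_isSemisimpleRing`) whose commutant is `R`. [cite: BourbakiAlgebreVIII2012, VIII §14 n°7 Prop. 4 a)]
[cite: Zarhin2018SuperellipticJacobians, §4 Thm. 4.1 (double centralizer)] [cite: MilneCM2006, Ch. I §3 Exercise 3.10 (a) (p. 29)] -/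
theorem adjoin_union_eq_centralizer_of_mul_finrank_eq (hd : finrank F L₀ = d₀ ^ 2 * finrank F ↥(Subalgebra.center F ↥L₀))
    (R₀ : Subalgebra F (Module.End F W)) (hRcomm : ∀ x ∈ R₀, ∀ y ∈ R₀, x * y = y * x) [IsReduced R₀]
    (hRL : R₀ ≤ Subalgebra.centralizer F (L₀ : Set (Module.End F W))) (hR : d₀ * finrank F R₀ = finrank F W) :
    Algebra.adjoin F ((L₀ : Set (Module.End F W)) ∪ (R₀ : Set (Module.End F W))) =
      Subalgebra.centralizer F (R₀ : Set (Module.End F W)) := by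
  haveI : Nontrivial W := nontrivial_of_isSimpleRing_le_end L₀
  haveI : IsSimpleRing (Module.End F W) := isSimpleRing_moduleEnd₆₂
  haveI := isSemisimpleRing_adjoin_union_of_le_centralizer L₀ R₀ hRcomm hRL
  have h := centralizer_centralizer_eq_of_isSemisimpleRing
    (Algebra.adjoin F ((L₀ : Set (Module.End F W)) ∪ (R₀ : Set (Module.End F W))))
  rw [centralizer_adjoin_union_eq_of_mul_finrank_eq L₀ hd R₀ hRcomm hRL hR] at h
  exact h.symm

/-- ★ **`[F[L ∪ R] : F]_red = dim_F W`** («equality holds for some `R` … only if … complex multiplication», as pure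
algebra): `F[L ∪ R] = C(R)` with `R` commutative reduced, and the commutant of a commutative reduced subalgebra of the
simple `End_F(W)` has the full reduced degree `[End_F(W) : F]_red = dim_F W` (`reducedDegree_centralizer_eq_of_comm`).
[cite: MilneCM2006, Ch. I §3 Exercise 3.10 (a) (p. 29), Prop. 3.3 (p. 27)] [cite: BourbakiAlgebreVIII2012, VIII §14 n°7 Cor. 1 and Prop. 4 a)] -/
theorem reducedDegree_adjoin_union_eq_finrank_of_mul_finrank_eq
    (hd : finrank F L₀ = d₀ ^ 2 * finrank F ↥(Subalgebra.center F ↥L₀))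
    (R₀ : Subalgebra F (Module.End F W)) (hRcomm : ∀ x ∈ R₀, ∀ y ∈ R₀, x * y = y * x) [IsReduced R₀]
    (hRL : R₀ ≤ Subalgebra.centralizer F (L₀ : Set (Module.End F W))) (hR : d₀ * finrank F R₀ = finrank F W) :
    reducedDegree F ↥(Algebra.adjoin F ((L₀ : Set (Module.End F W)) ∪ (R₀ : Set (Module.End F W)))) = finrank F W := by
  haveI : Nontrivial W := nontrivial_of_isSimpleRing_le_end L₀
  haveI : IsSimpleRing (Module.End F W) := isSimpleRing_moduleEnd₆₂
  rw [reducedDegree_eq_of_algEquiv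
      (Subalgebra.equivOfEq _ _ (adjoin_union_eq_centralizer_of_mul_finrank_eq L₀ hd R₀ hRcomm hRL hR)),
    reducedDegree_centralizer_eq_of_comm R₀ hRcomm, reducedDegree_moduleEnd]

/-- ★★ **EVERY SUBALGEBRA `E ⊇ L ∪ R` HAS `[E : F]_red = dim_F W`** (for `d · dim_F R = dim_F W`): `F[L ∪ R] ⊆ E ⊆ End_F(W)`
and `dim_F W = [F[L ∪ R]]_red ≤ [E]_red ≤ dim_F W` — Ex. 3.10 (a)'s «equality holds for some `R` only if `A` has complex
multiplication» with NO semisimplicity hypothesis on `E`. [cite: MilneCM2006, Ch. I §3 Exercise 3.10 (a) (p. 29), Def. 3.2, Prop. 3.3 (p. 27)]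
[cite: BourbakiAlgebreVIII2012, VIII §14 n°7 Prop. 4 a)] -/
theorem reducedDegree_eq_finrank_of_le_of_mul_finrank_eq
    (hd : finrank F L₀ = d₀ ^ 2 * finrank F ↥(Subalgebra.center F ↥L₀))
    (R₀ : Subalgebra F (Module.End F W)) (hRcomm : ∀ x ∈ R₀, ∀ y ∈ R₀, x * y = y * x) [IsReduced R₀]
    (hRL : R₀ ≤ Subalgebra.centralizer F (L₀ : Set (Module.End F W))) (hR : d₀ * finrank F R₀ = finrank F W)
    (E₀ : Subalgebra F (Module.End F W)) (hLE : L₀ ≤ E₀) (hRE : R₀ ≤ E₀) : reducedDegree F ↥E₀ = finrank F W := by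
  have hAE := adjoin_union_le_of_le L₀ hLE hRE
  refine le_antisymm (reducedDegree_le_finrank_of_le_end E₀) ?_
  rw [← reducedDegree_adjoin_union_eq_finrank_of_mul_finrank_eq L₀ hd R₀ hRcomm hRL hR]
  exact reducedDegree_le_of_injective (Subalgebra.inclusion hAE) (Subalgebra.inclusion_injective hAE)

/-- ★★ **EX. 3.10 (a), «equality holds for some `R` ONLY IF `A` has complex multiplication», FOR EVERY `ℚ`-HODGE STRUCTURE
(no polarization)**: a commutative reduced `R ⊆ E_φ ⊓ C(L)` with `d · dim_ℚ R = dim V` forces `[E_φ : ℚ]_red = dim V` — §3's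
`reducedDegree_endAlg_eq_finrank_of_mul_finrank_eq` without `H.IsPolarizable` (the semisimple `ℚ[L ∪ R] ⊆ E_φ` replaces `E_φ`
in the double-commutant step). [cite: MilneCM2006, Ch. I §3 Exercise 3.10 (a) (p. 29), Def. 3.2, Prop. 3.3 (p. 27)]
[cite: BourbakiAlgebreVIII2012, VIII §14 n°7 Prop. 4 a) (p. A VIII.260)] -/
theorem reducedDegree_endAlg_eq_finrank_of_mul_finrank_eq' (hLE : L ≤ H.endAlg)
    (hd : finrank ℚ L = d ^ 2 * finrank ℚ ↥(Subalgebra.center ℚ ↥L)) (R : Subalgebra ℚ (Module.End ℚ V))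
    (hRcomm : ∀ x ∈ R, ∀ y ∈ R, x * y = y * x) [IsReduced R]
    (hRle : R ≤ H.endAlg ⊓ Subalgebra.centralizer ℚ (L : Set (Module.End ℚ V))) (hR : d * finrank ℚ R = finrank ℚ V) :
    reducedDegree ℚ ↥H.endAlg = finrank ℚ V :=
  reducedDegree_eq_finrank_of_le_of_mul_finrank_eq L hd R hRcomm (fun _ hx ↦ (Algebra.mem_inf.1 (hRle hx)).2) hR
    H.endAlg hLE (fun _ hx ↦ (Algebra.mem_inf.1 (hRle hx)).1)

end NoPolarization

end HodgeStructure

end Literature.AlgebraicGeometry.Motives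

end
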